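import Mathlib
import HarnessLib

/-!
# BGM 2006 App. A4 — the ROUTING of fixed external sectors through an expansion tree, as a combinatorial ORIENTATION LEMMA

Topic `MathematicalPhysics/QuantumLattice/FermiRG`.  Benfatto–Giuliani–Mastropietro 2006, Lemma 2.4/2.5 ((2.97)–(2.98)) with App. A4: in the sector sum of an
expansion tree, `F` FIXED external sectors (`F = 3` resp. `F = 5`) produce a gain `γ^{h/2}` resp. `γ^{h}` — one «lump» per PAIR of further fixed legs, capped at two
(the floor table `min ((F−1)/2) 2` of the levelled kernel bounds (2.98)).  The gain is produced by ROUTING the fixed sectors to a vertex: step (A4.8) moves the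
sector sum of a tree line from the parent side to the child side (`Σ_{ω*} A(ω*)B(ω*) ≤ sup A · Σ B` instead of `Σ A · sup B`), i.e. it re-roots a subtree at one of its
fixed external legs.  Abstractly: every tree line carries an ORIENTATION saying at which endpoint its sector counts as fixed; a vertex `a` then reads its input at
the level `F_a` = (pin, at the root) + (known external legs landed at `a`) + (lines oriented towards `a`); `Σ_a F_a = F + #lines` for every orientation; and the
lemma is that an orientation exists with EVERY `F_a ≥ 1` (each vertex keeps a pin) and `Σ_a lumps(F_a) ≥ lumps(F)`.  We prove it by PARITY ROUTING: after
discarding known legs down to the largest odd `F′ ≤ min(F, 5)` (reading a vertex at a lower level is an upper bound), orient bottom-up so that every `F_a` is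
ODD; then `Σ_a (F_a − 1) = F′ − 1 ≤ 4` forces `F_a ≤ 5` and `Σ_a (F_a−1)/2 = (F′−1)/2 = lumps F`.

* `IsRootedTree par` (parent map on `Fin (n+1)` decreasing the index off the root `0`), `children`, `fixedCount par c o a`, `lumps F := min ((F−1)/2) 2`;
* `sum_fixedCount` (`Σ_a F_a = 1 + Σ c + n`), `exists_parityBits` (the triangular parity system on a rooted tree is solvable), `exists_odd_orientation`,
  `exists_le_sum_eq` (discarding knowns), and the lemma **`exists_orientation_lumps`**.
Pure finite combinatorics; no analysis.  (Used by the Hubbard KL programme's levelled tower, located-risk #10 «(I1)-LEV-FLOOR»: the door's level credit is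
`2^{−lumps(F_a)·J}` per vertex AFTER orientation, merged additively in the exponent.)
References: [cite: BenfattoGiulianiMastropietro2006, §2.8 Lemma 2.4/2.5 (2.97)–(2.98); App. A4 (A4.5)–(A4.8), items (1)–(3)].
-/

namespace Literature.MathematicalPhysics.QuantumLattice.FermiRG

namespace BGM2006Routing

open Finset

variable {n : ℕ}

/-! ## §1 Rooted trees on `Fin (n+1)`, orientations, fixed-slot counts -/

/-- **A rooted tree on `Fin (n+1)`** given by its parent map: the root is `0` and every other vertex's parent has a smaller index (so vertex `i ≠ 0` and the
line `i — par i` are in bijection, and children have larger indices than their parent). [cite: BenfattoGiulianiMastropietro2006, §2.4 (trees of the expansion)] -/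
def IsRootedTree (par : Fin (n + 1) → Fin (n + 1)) : Prop :=
  ∀ i : Fin (n + 1), (i : ℕ) ≠ 0 → (par i : ℕ) < i

/-- The children of `a`: the non-root vertices whose parent is `a`. [cite: BenfattoGiulianiMastropietro2006, §2.4] -/
def children (par : Fin (n + 1) → Fin (n + 1)) (a : Fin (n + 1)) : Finset (Fin (n + 1)) :=
  univ.filter fun i => (i : ℕ) ≠ 0 ∧ par i = a

/-- **The fixed-slot count of vertex `a`** under the known-leg profile `c` (number of known external legs landed at each vertex) and the orientation `o`
(`o i = true`: the line `i — par i` has its sector fixed at the CHILD `i`, the standard orientation; `false`: at the PARENT): the root's pin, plus the known legs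
at `a`, plus `a`'s root-ward line if standard, plus the children lines oriented towards `a`. [cite: BenfattoGiulianiMastropietro2006, App. A4 (A4.8)] -/
def fixedCount (par : Fin (n + 1) → Fin (n + 1)) (c : Fin (n + 1) → ℕ) (o : Fin (n + 1) → Bool) (a : Fin (n + 1)) : ℕ :=
  (if (a : ℕ) = 0 then 1 else 0) + c a + (if (a : ℕ) ≠ 0 ∧ o a = true then 1 else 0) + ((children par a).filter fun i => o i = false).card

/-- **The lump table** `lumps F = min ((F−1)/2) 2`: the number of `γ^{h/2}` gains of a kernel with `F` fixed sectors (BGM 2006 (2.98); the Hubbard tree's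
`levelGainExp`). [cite: BenfattoGiulianiMastropietro2006, §2.8 (2.98)] -/
def lumps (F : ℕ) : ℕ := min ((F - 1) / 2) 2

/-- `lumps` is monotone. [cite: BenfattoGiulianiMastropietro2006, §2.8 (2.98)] -/
theorem lumps_mono {F F' : ℕ} (h : F ≤ F') : lumps F ≤ lumps F' := by
  unfold lumps
  exact min_le_min (Nat.div_le_div_right (Nat.sub_le_sub_right h 1)) le_rfl

/-- `lumps F ≤ 2` (the cap of (2.98)). [cite: BenfattoGiulianiMastropietro2006, §2.8 (2.98)] -/
theorem lumps_le_two (F : ℕ) : lumps F ≤ 2 := min_le_right _ _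

/-- For odd `F ≤ 5`, `lumps F = (F − 1)/2` exactly: `2·lumps F + 1 = F` (F = 1, 3, 5 of (2.97)–(2.98)). [cite: BenfattoGiulianiMastropietro2006, §2.8 (2.97)–(2.98)] -/
theorem two_mul_lumps_add_one {F : ℕ} (hodd : Odd F) (h5 : F ≤ 5) : 2 * lumps F + 1 = F := by
  obtain ⟨k, rfl⟩ := hodd
  have hk : k ≤ 2 := by omega
  unfold lumps
  rw [show (2 * k + 1 - 1) / 2 = k by omega, min_eq_left hk]

/-! ## §2 The slot identity `Σ_a F_a = 1 + Σ_a c_a + n` -/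

/-- Every non-root vertex is a child of exactly its parent: `Σ_a #(children a ∩ P) = #{i ≠ 0 ∧ P i}`. [folklore] -/
private theorem sum_card_children_filter (par : Fin (n + 1) → Fin (n + 1)) (P : Fin (n + 1) → Prop) [DecidablePred P] :
    ∑ a, ((children par a).filter P).card = (univ.filter fun i : Fin (n + 1) => (i : ℕ) ≠ 0 ∧ P i).card := by
  classical
  rw [card_eq_sum_card_fiberwise (f := par) (t := univ) (fun _ _ => mem_univ _)]
  refine sum_congr rfl fun a _ => ?_
  rw [children, Finset.filter_filter, Finset.filter_filter]
  congr 1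
  exact Finset.filter_congr fun i _ => by tauto

/-- The number of non-root vertices is `n`. [folklore] -/
private theorem card_nonroot : (univ.filter fun i : Fin (n + 1) => (i : ℕ) ≠ 0).card = n := by
  have h : (univ.filter fun i : Fin (n + 1) => (i : ℕ) ≠ 0) = univ.erase 0 := by
    ext i
    rw [mem_filter, mem_erase]
    simp only [mem_univ, true_and, and_true]
    exact not_congr ⟨fun h => Fin.ext h, fun h => by rw [h]; rfl⟩
  rw [h, card_erase_of_mem (mem_univ _), card_univ, Fintype.card_fin, Nat.add_sub_cancel]

/-- **The slot identity**: `Σ_a fixedCount a = 1 + Σ_a c a + n` for every orientation (each line is counted exactly once, at one endpoint — the bookkeeping behind (A4.8)). [cite: BenfattoGiulianiMastropietro2006, App. A4 (A4.8)] -/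
theorem sum_fixedCount (par : Fin (n + 1) → Fin (n + 1)) (c : Fin (n + 1) → ℕ) (o : Fin (n + 1) → Bool) :
    ∑ a, fixedCount par c o a = 1 + ∑ a, c a + n := by
  classical
  unfold fixedCount
  rw [sum_add_distrib, sum_add_distrib, sum_add_distrib]
  have h0' : ∑ a : Fin (n + 1), (if (a : ℕ) = 0 then 1 else 0) = 1 := by
    rw [Finset.sum_eq_single (0 : Fin (n + 1))]
    · rfl
    · intro b _ hb
      have : (b : ℕ) ≠ 0 := fun h => hb (Fin.ext h)
      rw [if_neg this]
    · intro h; exact absurd (mem_univ _) h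
  have h1 : ∑ a : Fin (n + 1), (if (a : ℕ) ≠ 0 ∧ o a = true then 1 else 0) = (univ.filter fun i : Fin (n + 1) => (i : ℕ) ≠ 0 ∧ o i = true).card := by
    rw [card_filter]
  have h2 : ∑ a : Fin (n + 1), ((children par a).filter fun i => o i = false).card =
      (univ.filter fun i : Fin (n + 1) => (i : ℕ) ≠ 0 ∧ o i = false).card := sum_card_children_filter par _
  have h12 : (univ.filter fun i : Fin (n + 1) => (i : ℕ) ≠ 0 ∧ o i = true).card +
      (univ.filter fun i : Fin (n + 1) => (i : ℕ) ≠ 0 ∧ o i = false).card = n := by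
    have hn := card_nonroot (n := n)
    have hu : (univ.filter fun i : Fin (n + 1) => (i : ℕ) ≠ 0 ∧ o i = true) ∪
        (univ.filter fun i : Fin (n + 1) => (i : ℕ) ≠ 0 ∧ o i = false) = univ.filter fun i : Fin (n + 1) => (i : ℕ) ≠ 0 := by
      ext i; simp only [mem_union, mem_filter, mem_univ, true_and]
      constructor
      · rintro (⟨h, -⟩ | ⟨h, -⟩) <;> exact h
      · intro h; cases o i
        · exact Or.inr ⟨h, rfl⟩
        · exact Or.inl ⟨h, rfl⟩
    have hd : Disjoint (univ.filter fun i : Fin (n + 1) => (i : ℕ) ≠ 0 ∧ o i = true)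
        (univ.filter fun i : Fin (n + 1) => (i : ℕ) ≠ 0 ∧ o i = false) := by
      rw [disjoint_filter]; intro i _ h1 h2; rw [h1.2] at h2; exact Bool.noConfusion h2.2
    rw [← card_union_of_disjoint hd, hu, hn]
  rw [h0', h1, h2]
  omega

/-! ## §3 Parity routing: an orientation making every fixed-slot count odd -/

/-- **The triangular parity system on a rooted tree is solvable**: for any targets `t`, there are bits `x a ∈ {0,1}` with
`x a + Σ_{children i of a} x i ≡ t a (mod 2)` at every non-root vertex (solve bottom-up: children have larger indices). [folklore] -/
private theorem exists_parityBits {par : Fin (n + 1) → Fin (n + 1)} (hT : IsRootedTree par) (t : Fin (n + 1) → ℕ) :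
    ∃ x : Fin (n + 1) → ℕ, (∀ a, x a ≤ 1) ∧ ∀ a : Fin (n + 1), (a : ℕ) ≠ 0 → (x a + ∑ i ∈ children par a, x i) % 2 = t a % 2 := by
  classical
  -- downward induction on the index: equations hold at all non-root vertices `a ≥ k`
  suffices h : ∀ k : ℕ, ∃ x : Fin (n + 1) → ℕ, (∀ a, x a ≤ 1) ∧
      ∀ a : Fin (n + 1), (a : ℕ) ≠ 0 → k ≤ (a : ℕ) → (x a + ∑ i ∈ children par a, x i) % 2 = t a % 2 by
    obtain ⟨x, hx1, hx⟩ := h 0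
    exact ⟨x, hx1, fun a ha => hx a ha (Nat.zero_le _)⟩
  intro k
  induction' hk : n + 1 - k with m ih generalizing k
  · -- no vertex has index ≥ k
    refine ⟨fun _ => 0, fun _ => zero_le_one, fun a _ hka => ?_⟩
    have := a.isLt; omega
  · -- from `k + 1` to `k`
    obtain ⟨x, hx1, hx⟩ := ih (k + 1) (by omega)
    have hkn : k < n + 1 := by omega
    set v : Fin (n + 1) := ⟨k, hkn⟩ with hv
    set val : ℕ := (t v + ∑ i ∈ children par v, x i) % 2 with hval
    refine ⟨Function.update x v val, fun a => ?_, fun a ha hka => ?_⟩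
    · by_cases hav : a = v
      · subst hav; rw [Function.update_self, hval]; omega
      · rw [Function.update_of_ne hav]; exact hx1 a
    · -- children of any `a` with `k ≤ a` have index `> a ≥ k`, so they are untouched
      have hch : ∀ i ∈ children par a, Function.update x v val i = x i := by
        intro i hi
        rw [children, mem_filter] at hi
        have hlt : (a : ℕ) < i := by have := hT i hi.2.1; rw [hi.2.2] at this; exact this
        apply Function.update_of_ne
        intro hiv; rw [hiv, hv] at hlt; simp at hlt; omega
      rw [sum_congr rfl hch]
      by_cases hak : (a : ℕ) = k
      · have hav : a = v := Fin.ext hak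
        subst hav
        rw [Function.update_self]
        show (val + ∑ i ∈ children par v, x i) % 2 = t v % 2
        rw [hval]
        omega
      · rw [Function.update_of_ne (fun h => hak (by rw [h]))]
        exact hx a ha (by omega)

/-- **ODD ORIENTATION**: if `Σ c` is even there is an orientation with every fixed-slot count ODD (hence `≥ 1`). [cite: BenfattoGiulianiMastropietro2006, App. A4 items (1)–(3)] -/
theorem exists_odd_orientation {par : Fin (n + 1) → Fin (n + 1)} (hT : IsRootedTree par) (c : Fin (n + 1) → ℕ) (hc : Even (∑ a, c a)) :
    ∃ o : Fin (n + 1) → Bool, ∀ a, Odd (fixedCount par c o a) := by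
  classical
  -- targets: `x_a + Σ_{ch} x_i ≡ 1 + c_a + #children(a)`
  obtain ⟨x, hx1, hx⟩ := exists_parityBits hT (fun a => 1 + c a + (children par a).card)
  refine ⟨fun a => decide (x a = 1), ?_⟩
  -- the non-root vertices
  have hx01 : ∀ a, x a = 0 ∨ x a = 1 := fun a => by have := hx1 a; omega
  have hcard : ∀ a, ((children par a).filter fun i => decide (x i = 1) = false).card + ∑ i ∈ children par a, x i = (children par a).card := by
    intro a
    have hsum : ∑ i ∈ children par a, x i = ((children par a).filter fun i => x i = 1).card := by
      rw [card_filter]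
      exact sum_congr rfl fun i _ => by rcases hx01 i with h | h <;> simp [h]
    rw [hsum]
    have hfeq : ((children par a).filter fun i => decide (x i = 1) = false) = (children par a).filter fun i => ¬ x i = 1 := by
      ext i; simp
    rw [hfeq, add_comm]
    exact Finset.card_filter_add_card_filter_not _
  have hnonroot : ∀ a : Fin (n + 1), (a : ℕ) ≠ 0 → Odd (fixedCount par c (fun a => decide (x a = 1)) a) := by
    intro a ha
    have heq := hx a ha
    have hc' := hcard a
    unfold fixedCount
    rw [if_neg ha]
    have hxa : (if (a : ℕ) ≠ 0 ∧ decide (x a = 1) = true then 1 else 0) = x a := by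
      rcases hx01 a with h | h <;> simp [ha, h]
    rw [hxa, zero_add]
    -- `c a + x a + #{ch : x = 0}` with `#{ch : x = 0} + Σ x_i = #ch` and `x a + Σ x_i ≡ 1 + c a + #ch`
    rw [Nat.odd_iff]
    have h2 : (x a + ∑ i ∈ children par a, x i) % 2 = (1 + c a + (children par a).card) % 2 := heq
    set S := ∑ i ∈ children par a, x i with hS
    set Z := ((children par a).filter fun i => decide (x i = 1) = false).card with hZ
    set D := (children par a).card with hD
    omega
  -- the root by the slot identity
  intro a
  by_cases ha : (a : ℕ) = 0
  · have hsum := sum_fixedCount par c (fun a => decide (x a = 1))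
    -- all other vertices are odd; there are `n` of them; `Σ F = 1 + Σ c + n` with `Σ c` even ⇒ the root is odd
    have ha0 : a = 0 := Fin.ext ha
    subst ha0
    rw [← Finset.add_sum_erase _ _ (mem_univ (0 : Fin (n + 1)))] at hsum
    have hodd_rest : ∀ b ∈ univ.erase (0 : Fin (n + 1)), Odd (fixedCount par c (fun a => decide (x a = 1)) b) := fun b hb =>
      hnonroot b (by have := ne_of_mem_erase hb; rwa [Ne, Fin.ext_iff] at this)
    -- parity of a sum of `n` odd numbers
    have hpar : (∑ b ∈ univ.erase (0 : Fin (n + 1)), fixedCount par c (fun a => decide (x a = 1)) b) % 2 = n % 2 := by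
      have hn : (univ.erase (0 : Fin (n + 1))).card = n := by rw [card_erase_of_mem (mem_univ _), card_univ, Fintype.card_fin]; rfl
      rw [Finset.sum_nat_mod, sum_congr rfl (fun b hb => Nat.odd_iff.1 (hodd_rest b hb)), sum_const, smul_eq_mul, mul_one, hn]
    rw [Nat.odd_iff]
    obtain ⟨m, hm⟩ := hc
    omega
  · exact hnonroot a ha

/-! ## §4 Discarding known legs, and the lemma -/

/-- One can discard known legs down to any smaller total: for `k ≤ Σ f` there is `g ≤ f` pointwise with `Σ g = k`. [folklore] -/
private theorem exists_le_sum_eq {ι : Type*} [Fintype ι] [DecidableEq ι] (f : ι → ℕ) {k : ℕ} (hk : k ≤ ∑ i, f i) :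
    ∃ g : ι → ℕ, (∀ i, g i ≤ f i) ∧ ∑ i, g i = k := by
  classical
  -- induction on the excess `Σ f − k`
  suffices h : ∀ e : ℕ, ∀ f : ι → ℕ, ∑ i, f i = k + e → ∃ g : ι → ℕ, (∀ i, g i ≤ f i) ∧ ∑ i, g i = k from
    h (∑ i, f i - k) f (by omega)
  intro e
  induction e with
  | zero => intro f hf; exact ⟨f, fun _ => le_rfl, by omega⟩
  | succ e ih =>
    intro f hf
    -- some `f i` is positive; decrease it by one
    have hpos : ∃ i, 0 < f i := by
      by_contra hno
      have : ∑ i, f i = 0 := sum_eq_zero fun i _ => by have := not_exists.1 hno i; omega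
      omega
    obtain ⟨i, hi⟩ := hpos
    have hupd : ∑ j, Function.update f i (f i - 1) j + 1 = ∑ j, f j := by
      rw [← Finset.add_sum_erase _ (Function.update f i (f i - 1)) (mem_univ i), Function.update_self,
        sum_congr rfl (fun j hj => Function.update_of_ne (ne_of_mem_erase hj) _ _),
        ← Finset.add_sum_erase _ f (mem_univ i)]
      omega
    obtain ⟨g, hg, hgs⟩ := ih (Function.update f i (f i - 1)) (by omega)
    refine ⟨g, fun j => (hg j).trans ?_, hgs⟩
    by_cases hji : j = i
    · subst hji; rw [Function.update_self]; omega
    · rw [Function.update_of_ne hji]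

/-- **THE ORIENTATION LEMMA (BGM 2006 Lemma 2.4, combinatorial core).**  For every rooted tree on `Fin (n+1)`, every known-leg profile `c` with `1 + Σ c = F`
(`F` = pin + known legs of the output), there are a sub-profile `c′ ≤ c` (discarded legs are read at a lower level — an upper bound) and an orientation `o` with
every fixed-slot count in `[1, 5]` and `Σ_a lumps (F_a) = lumps F` — one `γ^{h/2}` per pair of further fixed legs, capped at two, routed to vertices.
[cite: BenfattoGiulianiMastropietro2006, §2.8 Lemma 2.4 (2.97); App. A4 (A4.5)–(A4.8) items (1)–(3)] -/
theorem exists_orientation_lumps {par : Fin (n + 1) → Fin (n + 1)} (hT : IsRootedTree par) (c : Fin (n + 1) → ℕ) {F : ℕ} (hF : 1 + ∑ a, c a = F) :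
    ∃ (c' : Fin (n + 1) → ℕ) (o : Fin (n + 1) → Bool), (∀ a, c' a ≤ c a) ∧ (∀ a, 1 ≤ fixedCount par c' o a) ∧ (∀ a, fixedCount par c' o a ≤ 5) ∧
      ∑ a, lumps (fixedCount par c' o a) = lumps F := by
  classical
  -- the largest odd `F′ ≤ min F 5`
  set F' : ℕ := if 5 ≤ F then 5 else if 3 ≤ F then 3 else 1 with hF'
  have hF'odd : Odd F' := by rw [hF']; split_ifs <;> decide
  have hF'5 : F' ≤ 5 := by rw [hF']; split_ifs <;> omega
  have hF'F : F' ≤ F := by rw [hF']; split_ifs <;> omega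
  have hlumps : lumps F' = lumps F := by
    rw [hF']; unfold lumps; split_ifs <;> omega
  -- discard known legs down to `F′ − 1`
  obtain ⟨c', hc'le, hc'sum⟩ := exists_le_sum_eq c (k := F' - 1) (by omega)
  have heven : Even (∑ a, c' a) := by
    rw [hc'sum]; obtain ⟨k, hk⟩ := hF'odd; exact ⟨k, by omega⟩
  obtain ⟨o, hodd⟩ := exists_odd_orientation hT c' heven
  have hsum := sum_fixedCount par c' o
  rw [hc'sum] at hsum
  -- all counts odd, total `F′ + n` over `n + 1` vertices ⇒ each `≤ 5` and the lumps add up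
  have h1 : ∀ a, 1 ≤ fixedCount par c' o a := fun a => by obtain ⟨k, hk⟩ := hodd a; omega
  -- `Σ (F_a − 1) = F′ − 1`
  have hsub : ∑ a, (fixedCount par c' o a - 1) = F' - 1 := by
    have h := Finset.sum_tsub_distrib (s := univ) (f := fun a => fixedCount par c' o a) (g := fun _ => 1) (fun a _ => h1 a)
    rw [h, hsum, sum_const, card_univ, Fintype.card_fin, smul_eq_mul, mul_one]
    omega
  have h5 : ∀ a, fixedCount par c' o a ≤ 5 := by
    intro a
    have := Finset.single_le_sum (f := fun a => fixedCount par c' o a - 1) (fun _ _ => Nat.zero_le _) (mem_univ a)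
    rw [hsub] at this
    omega
  refine ⟨c', o, hc'le, h1, h5, ?_⟩
  -- `2·lumps(F_a) + 1 = F_a` termwise, sum, compare with `2·lumps F′ + 1 = F′`
  have hterm : ∀ a, 2 * lumps (fixedCount par c' o a) + 1 = fixedCount par c' o a := fun a => two_mul_lumps_add_one (hodd a) (h5 a)
  have h2 : 2 * ∑ a, lumps (fixedCount par c' o a) + (n + 1) = F' + n := by
    have hF1 : 1 ≤ F' := by obtain ⟨k, hk⟩ := hF'odd; omega
    have : ∑ a : Fin (n + 1), (2 * lumps (fixedCount par c' o a) + 1) = ∑ a, fixedCount par c' o a := sum_congr rfl fun a _ => hterm a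
    rw [sum_add_distrib, sum_const, card_univ, Fintype.card_fin, smul_eq_mul, mul_one, ← mul_sum] at this
    omega
  have h3 := two_mul_lumps_add_one hF'odd hF'5
  rw [← hlumps]
  omega

end BGM2006Routing

end Literature.MathematicalPhysics.QuantumLattice.FermiRG
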